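import Summits.Langlands.Langlands.Theorems.PhantomRMYoshidaResiduallyYoshidaLiftingSplit
import Summits.Langlands.Langlands.Theorems.PhantomRMYoshidaStableYoshidaCongruenceResidualLattice
import Summits.Langlands.Langlands.Theorems.PhantomRMYoshidaStableYoshidaCongruenceOrdinaryFrameFp
import Literature.NumberTheory.GaloisRepresentations.CyclotomicDeterminantImageProofs
import Literature.NumberTheory.GaloisRepresentations.OddAbsolutelyIrreducibleProofs
import Literature.NumberTheory.NumberFields.CongruenceSubgroupTorsionFree
import HarnessLib

/-!
# Route `PhantomRMYoshida`, crux `ResiduallyYoshidaLifting` (stmt-Langlands-13639), line `sector-klingen-split`: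
# the corner `KlingenDensityCorner` is VACUOUS on its cyclotomic-reducible clauses for `p ≥ 5`

Worker of lead prover-line-stmt-Langlands-13639-c3-0 (2026-08-17), stub `stub_klingenDensityCorner` (KL1 off the
generic sector: `p = 3`, or a constituent NOT absolutely irreducible on `Γ_{ℚ(ζ_p)}`, or a twist pair).
Registered sub-goal `stub_cornerVacuous_cyclotomicReducible` (`--supports stmt-Langlands-13639`), PROVED (no `sorry`,
standard axioms, nothing taken as a hypothesis): for `p ≥ 5`, on every residual fibre `(σ̄, σ̄')` (irreducible,
`det σ̄ = det σ̄' = ε̄⁻¹`) carrying ONE `Sh`-point, both `σ̄|Γ_{ℚ(ζ_p)}` and `σ̄'|Γ_{ℚ(ζ_p)}` are absolutely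
irreducible; hence (`twistPair_of_not_genericSector`) off the generic sector with `p ≥ 5` an `Sh`-fibre is a TWIST
fibre — the corner is exactly `{p = 3} ∪ {twist fibres, p ≥ 5}`.

Proof ("free `p`-ordinarity excludes the bad-dihedral case in weight 2 unless `p = 3`", as in Wiles 1995):
1. (landed for crux `StableYoshidaCongruence`) `stub_residualLattice` + `finrank_invariants_inertia_eq_one`: reducing a
   Greenberg-adapted stable lattice of `ρ` and Brauer–Nesbitt, the inertia invariants of `σ̄|Γ_{ℚ_p}` are a LINE.
2. `det σ̄ = ε̄⁻¹`, `ε̄(c) = -1`: `σ̄` is odd, so absolutely irreducible (`2 ≠ 0` in `k`).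
3. `σ̄|Γ_{ℚ(ζ_p)}` not absolutely irreducible gives, after a base change `f : k → B`, a common eigenvector `v₀` of
   `σ̄(n)`, `ε̄(n) = 1` (tree: `exists_eigenvector_of_not_isAbsolutelyIrreducible`, `mem_range_absGaloisRestrict_…`).
4. `ε̄(I_p) = 𝔽_pˣ` (tree, local Kronecker–Weber): `τ₀ ∈ I_p` with `ε̄(τ₀) = u` a generator.  ELEMENTARY CORE
   `det_eq_neg_one_of_eigenline`: `A = σ̄(τ₀)` fixes `w ≠ 0`, normalises `N = ker ε̄`, `Γ_ℚ = ⟨N, τ₀⟩`; `v₀, A v₀`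
   are non-proportional `N`-eigenvectors; equal `N`-characters would make `N` scalar and `B w` stable; else
   `A² v₀ ∈ B v₀`, `tr A = 0` (Cayley–Hamilton), and the eigenvalue `1` forces `det A = -1 = u⁻¹`: `u = -1`
   generates `𝔽_pˣ`, `p - 1 ∣ 2`, `p ≤ 3`.
-/


noncomputable section

-- `Summit.Langlands.Langlands.…` (summit = sub-problem name, D-0017 layout) trips `dupNamespace` on every decl.
set_option linter.dupNamespace false
set_option autoImplicit false

open IsDedekindDomain Module Matrix
open scoped NumberField
open Literature Literature.NumberTheory.GaloisRepresentations Literature.NumberTheory.Automorphic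
open Summit.Langlands.Langlands.Cruxes.ResiduallyYoshidaLifting.YoshidaDivisorSelmerCount
open Summit.Langlands.Langlands.Cruxes.ResiduallyYoshidaLifting.SectorSplit
open Summit.Langlands.Langlands.Cruxes.StableYoshidaCongruence.BurkhardtWeddleTwoThreeAnchor
  (stub_residualLattice finrank_invariants_inertia_eq_one det_val_eq_of_det_eq)
open Summit.Langlands.Langlands.Cruxes.StableYoshidaCongruence.LevelThreeWeierstrassSwitch
  (primesEquiv_eq_of_natCast_mem)

namespace Summit.Langlands.Langlands.Cruxes.ResiduallyYoshidaLifting.SectorKlingenSplit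

/-! ## The elementary core: plane representations with an eigenline for `ker ε` -/

section Core

variable {Γ B C : Type*} [Group Γ] [Field B] [CommGroup C]

/-- Cayley–Hamilton for `2 × 2` matrices, on vectors: `A (A x) = tr A • A x - det A • x`. [folklore] -/
theorem mulVec_mulVec_fin_two (A : Matrix (Fin 2) (Fin 2) B) (x : Fin 2 → B) :
    A *ᵥ (A *ᵥ x) = A.trace • (A *ᵥ x) - A.det • x := by
  ext i
  fin_cases i <;>
    simp [Matrix.mulVec, dotProduct, Fin.sum_univ_two, Matrix.trace_fin_two, Matrix.det_fin_two] <;> ring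

/-- If `x ≠ 0` is a common eigenvector of `T(ker ε)` and of `T τ₀`, `ε τ₀` generating the target of
`ε`, then the line `B x` is `T(Γ)`-stable (its stabiliser is a subgroup) — excluded by `hirr`. [folklore] -/
theorem not_eigenline_of_generator (T : Γ →* GL (Fin 2) B) (ε : Γ →* C) (τ₀ : Γ)
    (hu : ∀ c : C, c ∈ Subgroup.zpowers (ε τ₀))
    (hirr : ∀ x : Fin 2 → B, x ≠ 0 → ∃ g, ∀ a : B, (T g).val *ᵥ x ≠ a • x)
    {x : Fin 2 → B} (hx : x ≠ 0) (hev : ∀ n, ε n = 1 → ∃ a : B, (T n).val *ᵥ x = a • x)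
    (hτ₀ : ∃ c : B, (T τ₀).val *ᵥ x = c • x) : False := by
  let H : Subgroup Γ :=
    { carrier := {g | ∃ a : B, (T g).val *ᵥ x = a • x}
      one_mem' := ⟨1, by simp⟩
      mul_mem' := fun {g h} hg hh => by
        obtain ⟨a, ha⟩ := hg
        obtain ⟨b, hb⟩ := hh
        exact ⟨b * a, by
          rw [map_mul, Units.val_mul, ← Matrix.mulVec_mulVec, hb, Matrix.mulVec_smul, ha, smul_smul]⟩
      inv_mem' := fun {g} hg => by
        obtain ⟨a, ha⟩ := hg
        have h1 : (T g⁻¹).val *ᵥ ((T g).val *ᵥ x) = x := by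
          rw [Matrix.mulVec_mulVec, map_inv, Units.inv_mul, Matrix.one_mulVec]
        rw [ha, Matrix.mulVec_smul] at h1
        have ha0 : a ≠ 0 := by
          rintro rfl
          rw [zero_smul] at h1
          exact hx h1.symm
        exact ⟨a⁻¹, by rw [eq_inv_smul_iff₀ ha0, h1]⟩ }
  have hN : ∀ n, ε n = 1 → n ∈ H := fun n hn => hev n hn
  have hτ : τ₀ ∈ H := hτ₀
  obtain ⟨g, hg⟩ := hirr x hx
  obtain ⟨i, hi⟩ := Subgroup.mem_zpowers_iff.1 (hu (ε g))
  have hn : g * (τ₀ ^ i)⁻¹ ∈ H := hN _ (by rw [map_mul, map_inv, map_zpow, hi, mul_inv_cancel])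
  have hgH : g ∈ H := by
    have := H.mul_mem hn (H.zpow_mem hτ i)
    rwa [inv_mul_cancel_right] at this
  obtain ⟨a, ha⟩ := hgH
  exact hg a ha

/-- `T τ₀` maps common eigenvectors of `T(ker ε)` to common eigenvectors (`C` is commutative). [folklore] -/
theorem eigen_mulVec_of_eigen (T : Γ →* GL (Fin 2) B) (ε : Γ →* C) (τ₀ : Γ) {x : Fin 2 → B}
    (hev : ∀ n, ε n = 1 → ∃ a : B, (T n).val *ᵥ x = a • x) :
    ∀ n, ε n = 1 → ∃ a : B, (T n).val *ᵥ ((T τ₀).val *ᵥ x) = a • ((T τ₀).val *ᵥ x) := by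
  intro n hn
  obtain ⟨a, ha⟩ := hev (τ₀⁻¹ * n * τ₀)
    (by rw [map_mul, map_mul, map_inv, hn, mul_one, inv_mul_cancel])
  refine ⟨a, ?_⟩
  have hgrp : n * τ₀ = τ₀ * (τ₀⁻¹ * n * τ₀) := by group
  have hmat : (T n).val * (T τ₀).val = (T τ₀).val * (T (τ₀⁻¹ * n * τ₀)).val := by
    rw [← Units.val_mul, ← Units.val_mul, ← map_mul, ← map_mul, hgrp]
  rw [Matrix.mulVec_mulVec, hmat, ← Matrix.mulVec_mulVec, ha, Matrix.mulVec_smul]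

/-- **The elementary core.**  `T : Γ → GL₂(B)`, `ε : Γ → C` with `ε τ₀` generating `C`; no line of
`B²` is `T(Γ)`-stable; `v₀ ≠ 0` is a common eigenvector of `T(ker ε)`; and `T τ₀` fixes some `w ≠ 0`.
Then `det T(τ₀) = -1` (step 4 of the file header). [folklore] -/
theorem det_eq_neg_one_of_eigenline (T : Γ →* GL (Fin 2) B) (ε : Γ →* C) (τ₀ : Γ)
    (hu : ∀ c : C, c ∈ Subgroup.zpowers (ε τ₀))
    (hirr : ∀ x : Fin 2 → B, x ≠ 0 → ∃ g, ∀ a : B, (T g).val *ᵥ x ≠ a • x)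
    {v₀ : Fin 2 → B} (hv₀ : v₀ ≠ 0) (hev : ∀ n, ε n = 1 → ∃ a : B, (T n).val *ᵥ v₀ = a • v₀)
    {w : Fin 2 → B} (hw : w ≠ 0) (hfix : (T τ₀).val *ᵥ w = w) :
    (T τ₀).val.det = -1 := by
  have hCH := mulVec_mulVec_fin_two (T τ₀).val
  have hn0 : ∀ c : B, (T τ₀).val *ᵥ v₀ ≠ c • v₀ := fun c hc =>
    not_eigenline_of_generator T ε τ₀ hu hirr hv₀ hev ⟨c, hc⟩
  have hev₁ := eigen_mulVec_of_eigen T ε τ₀ hev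
  obtain ⟨v₁, hv₁⟩ : ∃ v₁, (T τ₀).val *ᵥ v₀ = v₁ := ⟨_, rfl⟩
  rw [hv₁] at hn0 hev₁
  have hev₂ := eigen_mulVec_of_eigen T ε τ₀ hev₁
  have hli : ∀ a b : B, a • v₀ + b • v₁ = 0 → a = 0 ∧ b = 0 := by
    intro a b hab
    by_cases hb : b = 0
    · rw [hb, zero_smul, add_zero] at hab
      exact ⟨(smul_eq_zero.1 hab).resolve_right hv₀, hb⟩
    · exfalso
      have h1 : b • v₁ = -(a • v₀) := eq_neg_of_add_eq_zero_right hab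
      have h2 : v₁ = -(b⁻¹ • a • v₀) := by
        have := congrArg (fun y => b⁻¹ • y) h1
        simpa only [smul_smul, inv_mul_cancel₀ hb, one_smul, smul_neg] using this
      exact hn0 (-(b⁻¹ * a)) (by rw [h2, neg_smul, mul_smul])
  have hli' : LinearIndependent B ![v₀, v₁] := by
    rw [LinearIndependent.pair_iff]
    exact fun s t hst => hli s t hst
  have hcard : Fintype.card (Fin 2) = finrank B (Fin 2 → B) := by simp
  let bs := basisOfLinearIndependentOfCardEqFinrank hli' hcard
  have hspan : ∀ x : Fin 2 → B, ∃ a b : B, x = a • v₀ + b • v₁ := fun x => by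
    refine ⟨bs.repr x 0, bs.repr x 1, ?_⟩
    have hx := bs.sum_repr x
    rw [Fin.sum_univ_two] at hx
    simp only [bs, coe_basisOfLinearIndependentOfCardEqFinrank, Matrix.cons_val_zero,
      Matrix.cons_val_one] at hx
    exact hx.symm
  by_cases hagree :
      ∀ n, ε n = 1 → ∃ a : B, (T n).val *ᵥ v₀ = a • v₀ ∧ (T n).val *ᵥ v₁ = a • v₁
  · -- `ker ε` acts by scalars: `w` is a common eigenvector fixed by `T τ₀` — excluded
    exfalso
    obtain ⟨α, β, hwab⟩ := hspan w
    refine not_eigenline_of_generator T ε τ₀ hu hirr hw (fun n hn => ?_)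
      ⟨1, by rw [one_smul]; exact hfix⟩
    obtain ⟨a, ha₀, ha₁⟩ := hagree n hn
    refine ⟨a, ?_⟩
    rw [hwab, Matrix.mulVec_add, Matrix.mulVec_smul, Matrix.mulVec_smul, ha₀, ha₁, smul_add,
      smul_comm a α, smul_comm a β]
  · push Not at hagree
    obtain ⟨n₀, hn₀, hne⟩ := hagree
    obtain ⟨a₀, ha₀⟩ := hev n₀ hn₀
    obtain ⟨a₁, ha₁⟩ := hev₁ n₀ hn₀
    have hne' : a₁ ≠ a₀ := fun h => hne a₀ ha₀ (h ▸ ha₁)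
    obtain ⟨α, β, hAv₁⟩ := hspan ((T τ₀).val *ᵥ v₁)
    obtain ⟨γ, hγ⟩ := hev₂ n₀ hn₀
    rw [hAv₁, Matrix.mulVec_add, Matrix.mulVec_smul, Matrix.mulVec_smul, ha₀, ha₁] at hγ
    have hcoef : (α * a₀ - γ * α) • v₀ + (β * a₁ - γ * β) • v₁ = 0 := by
      linear_combination (norm := module) hγ
    obtain ⟨h₁, h₂⟩ := hli _ _ hcoef
    have hα : α ≠ 0 := by
      intro hα0
      rw [hα0, zero_smul, zero_add] at hAv₁
      apply hn0 β
      have hker : (T τ₀).val *ᵥ (v₁ - β • v₀) = 0 := by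
        rw [Matrix.mulVec_sub, Matrix.mulVec_smul, hAv₁, hv₁, sub_self]
      have hinj : v₁ - β • v₀ = 0 := by
        have := congrArg (fun y => ((T τ₀)⁻¹ : GL (Fin 2) B).val *ᵥ y) hker
        simpa only [Matrix.mulVec_mulVec, Units.inv_mul, Matrix.one_mulVec,
          Matrix.mulVec_zero] using this
      exact sub_eq_zero.1 hinj
    have hγa₀ : γ = a₀ := by
      have : α * (a₀ - γ) = 0 := by linear_combination h₁
      exact (sub_eq_zero.1 ((mul_eq_zero.1 this).resolve_left hα)).symm
    have hβ : β = 0 := by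
      by_contra hβ
      have : β * (a₁ - γ) = 0 := by linear_combination h₂
      exact hne' ((sub_eq_zero.1 ((mul_eq_zero.1 this).resolve_left hβ)).trans hγa₀)
    rw [hβ, zero_smul, add_zero] at hAv₁
    have htr : ((T τ₀).val).trace = 0 := by
      have h := hCH v₀
      rw [hv₁, hAv₁] at h
      have hc : (α + ((T τ₀).val).det) • v₀ + (-((T τ₀).val).trace) • v₁ = 0 := by
        linear_combination (norm := module) h
      exact neg_eq_zero.1 (hli _ _ hc).2
    have h := hCH w
    rw [hfix, hfix, htr, zero_smul, zero_sub] at h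
    have h2 : (1 + ((T τ₀).val).det) • w = 0 := by
      rw [add_smul, one_smul]
      linear_combination (norm := module) h
    rcases smul_eq_zero.1 h2 with h3 | h3
    · linear_combination h3
    · exact absurd h3 hw

end Core

/-- An absolutely irreducible framed plane representation has no common eigenvector after any base
change `f : A → B`. [folklore] -/
theorem exists_mulVec_ne_smul_of_isAbsolutelyIrreducible {G : Type*} [Group G] [TopologicalSpace G]
    {A : Type} [Field A] [TopologicalSpace A] (ρ : FramedRep G A 2) (h : ρ.IsAbsolutelyIrreducible)
    {B : Type} [Field B] (f : A →+* B) {x : Fin 2 → B} (hx : x ≠ 0) :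
    ∃ g : G, ∀ a : B, (((ρ g : GL (Fin 2) A) : Matrix (Fin 2) (Fin 2) A).map f) *ᵥ x ≠ a • x := by
  by_contra hall
  push Not at hall
  have hB := h B f
  let S : Subrepresentation (ρ.baseChangeRepresentation f) :=
    { toSubmodule := Submodule.span B {x}
      apply_mem_toSubmodule := fun g y hy => by
        obtain ⟨b, rfl⟩ := Submodule.mem_span_singleton.mp hy
        obtain ⟨a, ha⟩ := hall g
        rw [map_smul, FramedRep.baseChangeRepresentation_apply_apply]
        change b • ((((ρ g : GL (Fin 2) A) : Matrix (Fin 2) (Fin 2) A).map f) *ᵥ x) ∈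
          Submodule.span B {x}
        rw [ha, smul_smul]
        exact Submodule.mem_span_singleton.mpr ⟨b * a, rfl⟩ }
  have h2 : finrank B (Fin 2 → B) = 2 := Module.finrank_fin_fun B
  have hS :=
    Literature.RepresentationTheory.FiniteGroups.Representation.ne_bot_and_ne_top_of_finrank_eq_one
      h2 (finrank_span_singleton hx)
  rcases hB.eq_bot_or_eq_top S with h' | h'
  · exact hS.1 (congrArg Subrepresentation.toSubmodule h')
  · exact hS.2 (congrArg Subrepresentation.toSubmodule h')

/-! ## The vacuity theorem -/

/-- A non-zero inertia-fixed vector from "the inertia invariants form a line". [folklore] -/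
theorem exists_inertia_fixed_of_finrank_invariants_eq_one {k : Type} [Field k] [TopologicalSpace k]
    (σ : FramedGaloisRep ℚ k 2) (v : HeightOneSpectrum (𝓞 ℚ))
    (h : finrank k (Representation.invariants (σ.toRepresentation.comp
      ((absGaloisRestrict ℚ (v.adicCompletion ℚ)).toMonoidHom.comp
        (absInertia (v.adicCompletion ℚ)).subtype))) = 1) :
    ∃ w : Fin 2 → k, w ≠ 0 ∧ ∀ t ∈ absInertia (v.adicCompletion ℚ),
      ((σ (absGaloisRestrict ℚ (v.adicCompletion ℚ) t) : GL (Fin 2) k) : Matrix (Fin 2) (Fin 2) k) *ᵥ w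
        = w := by
  set R := σ.toRepresentation.comp ((absGaloisRestrict ℚ (v.adicCompletion ℚ)).toMonoidHom.comp
    (absInertia (v.adicCompletion ℚ)).subtype)
  have hne : Representation.invariants R ≠ ⊥ := by
    intro hbot
    rw [← Submodule.finrank_eq_zero (R := k), h] at hbot
    exact one_ne_zero hbot
  obtain ⟨w, hwmem, hw0⟩ := Submodule.exists_mem_ne_zero_of_ne_bot hne
  refine ⟨w, hw0, fun t ht => ?_⟩
  exact (Representation.mem_invariants R w).1 hwmem ⟨t, ht⟩

/-- **Free `p`-ordinarity excludes the bad-dihedral case for `p ≥ 5`.**  `p ≥ 5`, `k` of characteristic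
`p`, `τ : Γ_ℚ → GL₂(k)` irreducible with `det τ = ε̄⁻¹`, some `w ≠ 0` fixed by `τ(I_{ℚ_v})`, `v ∣ p`: then
`τ|Γ_{ℚ(ζ_p)}` is absolutely irreducible (steps 2–4 of the file header). [folklore] -/
theorem isAbsolutelyIrreducible_restrictField_cyclotomic_of_inertia_fixed {p : ℕ} [Fact p.Prime]
    (hp5 : 5 ≤ p) {k : Type} [Field k] [CharP k p] [TopologicalSpace k] [DiscreteTopology k]
    (τ : FramedGaloisRep ℚ k 2) (hirr : τ.toGaloisRep.IsIrreducible)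
    (hdet : ∀ g, FramedRep.det τ g =
      (Units.map (ZMod.castHom (dvd_refl p) k).toMonoidHom (εb p g))⁻¹)
    (v : HeightOneSpectrum (𝓞 ℚ)) (hv : ((p : ℕ) : 𝓞 ℚ) ∈ v.asIdeal) {w : Fin 2 → k} (hw : w ≠ 0)
    (hfix : ∀ t ∈ absInertia (v.adicCompletion ℚ),
      ((τ (absGaloisRestrict ℚ (v.adicCompletion ℚ) t) : GL (Fin 2) k) : Matrix (Fin 2) (Fin 2) k) *ᵥ w
        = w) :
    FramedRep.IsAbsolutelyIrreducible (FramedGaloisRep.restrictField (CyclotomicField p ℚ) τ) := by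
  have hp := (Fact.out : p.Prime)
  by_contra hnot
  obtain ⟨B, _, f, v₀, hv₀, hB⟩ := FramedRep.exists_eigenvector_of_not_isAbsolutelyIrreducible _ hnot
  let ι : ZMod p →+* k := ZMod.castHom (dvd_refl p) k
  let T : Field.absoluteGaloisGroup ℚ →* GL (Fin 2) B :=
    (Matrix.GeneralLinearGroup.map f).comp τ.toMonoidHom
  have hT : ∀ g, (T g).val = ((τ g : GL (Fin 2) k) : Matrix (Fin 2) (Fin 2) k).map f := fun g => rfl
  -- (2) `τ` is odd, hence absolutely irreducible
  have h2k : (2 : k) ≠ 0 := by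
    rw [show (2 : k) = ((2 : ℕ) : k) by norm_num, Ne, CharP.cast_eq_zero_iff k p]
    intro h
    have := Nat.le_of_dvd two_pos h
    omega
  obtain ⟨c, hc⟩ := exists_isComplexConjugation (Rat.castHom ℝ)
  have hεc : ((εb p c : (ZMod p)ˣ) : ZMod p) = -1 :=
    modNCyclotomicCharacter_of_isComplexConjugation (N := p) hc
  have hu1 : εb p c = -1 := Units.ext (by rw [hεc, Units.val_neg, Units.val_one])
  have hinv : ((-1 : (ZMod p)ˣ))⁻¹ = -1 := inv_eq_of_mul_eq_one_right (by rw [neg_mul_neg, one_mul])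
  have hdetc : Matrix.GeneralLinearGroup.det (τ c) = -1 := by
    have h1 : ((τ c : GL (Fin 2) k) : Matrix (Fin 2) (Fin 2) k).det =
        ι (((εb p c)⁻¹ : (ZMod p)ˣ) : ZMod p) := det_val_eq_of_det_eq (hdet c)
    rw [hu1, hinv, Units.val_neg, Units.val_one, map_neg, map_one] at h1
    exact Units.ext (by rw [Matrix.GeneralLinearGroup.val_det_apply, h1, Units.val_neg, Units.val_one])
  have habs : τ.IsAbsolutelyIrreducible :=
    FramedRep.isAbsolutelyIrreducible_of_isIrreducible_of_det_eq_neg_one τ hirr h2k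
      (by rw [← sq]; exact hc.sq_eq_one) hdetc
  have hirrT : ∀ x : Fin 2 → B, x ≠ 0 → ∃ g, ∀ a : B, (T g).val *ᵥ x ≠ a • x := fun x hx =>
    exists_mulVec_ne_smul_of_isAbsolutelyIrreducible τ habs f hx
  -- (3) `v₀` is a common eigenvector of `T(ker ε̄)`
  have hev : ∀ n, εb p n = 1 → ∃ a : B, (T n).val *ᵥ v₀ = a • v₀ := by
    intro n hn
    have hn' : modPCyclotomicCharacterZMod ℚ p n = 1 := hn
    haveI : NeZero ((p : ℕ) : ℚ) := NeZero.charZero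
    haveI : IsCyclotomicExtension {p} ℚ (CyclotomicField p ℚ) :=
      CyclotomicField.isCyclotomicExtension p ℚ
    obtain ⟨m, rfl⟩ := MonoidHom.mem_range.1
      (mem_range_absGaloisRestrict_of_modPCyclotomicCharacterZMod_eq_one ℚ p (CyclotomicField p ℚ) hn')
    exact hB m
  -- (4) an inertia element `τ₀` with `ε̄(τ₀) = u` a generator of `𝔽_pˣ`
  obtain ⟨u, hu⟩ := IsCyclic.exists_generator (α := (ZMod p)ˣ)
  have hn0 : (u : ZMod p).val ≠ 0 := fun h => u.ne_zero ((ZMod.val_eq_zero _).1 h)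
  have hndvd : ¬ p ∣ (u : ZMod p).val := fun h =>
    hn0 (Nat.eq_zero_of_dvd_of_lt h (ZMod.val_lt _))
  have hunit : IsUnit (((u : ZMod p).val : ℤ_[p])) := by
    rw [PadicInt.isUnit_iff]
    refine le_antisymm (PadicInt.norm_le_one _) (not_lt.1 fun hlt => hndvd ?_)
    rw [← Int.cast_natCast, PadicInt.norm_int_lt_one_iff_dvd] at hlt
    exact_mod_cast hlt
  obtain ⟨t, ht, htu⟩ := adicCompletion_rat_exists_mem_absInertia_cyclotomicCharacter_eq p v
    (primesEquiv_eq_of_natCast_mem p v hv) hunit.unit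
  have hτ₀ : εb p (absGaloisRestrict ℚ (v.adicCompletion ℚ) t) = u := by
    apply Units.ext
    have h := toZMod_cyclotomicCharacter_apply ℚ p (absGaloisRestrict ℚ (v.adicCompletion ℚ) t)
    rw [cyclotomicCharacter_absGaloisRestrict, htu, IsUnit.unit_spec, map_natCast,
      ZMod.natCast_zmod_val] at h
    exact h.symm
  have hw' : (f ∘ w) ≠ 0 := by
    intro h
    apply hw
    funext i
    simpa using congrFun h i
  have hfix' : (T (absGaloisRestrict ℚ (v.adicCompletion ℚ) t)).val *ᵥ (f ∘ w) = f ∘ w := by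
    rw [hT]
    funext i
    rw [← RingHom.map_mulVec, hfix t ht]
    rfl
  -- the core: `det T(τ₀) = -1`, i.e. `u⁻¹ = -1`, i.e. `u = -1` generates `𝔽_pˣ`: `p ≤ 3`
  have hdetT := det_eq_neg_one_of_eigenline T (εb p) (absGaloisRestrict ℚ (v.adicCompletion ℚ) t)
    (by rw [hτ₀]; exact hu) hirrT hv₀ hev hw' hfix'
  have hdetk : ((τ (absGaloisRestrict ℚ (v.adicCompletion ℚ) t) : GL (Fin 2) k) :
      Matrix (Fin 2) (Fin 2) k).det = ι (((u⁻¹ : (ZMod p)ˣ) : ZMod p)) := by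
    rw [← hτ₀]; exact det_val_eq_of_det_eq (hdet _)
  have hf : f (ι ((u⁻¹ : (ZMod p)ˣ) : ZMod p)) = f (-1) := by
    rw [← hdetk, RingHom.map_det, RingHom.mapMatrix_apply, ← hT, hdetT, map_neg, map_one]
  have hι : ((u⁻¹ : (ZMod p)ˣ) : ZMod p) = -1 :=
    ι.injective (by rw [f.injective hf, map_neg, map_one])
  have hu2 : u = -1 := by
    have hui : u⁻¹ = -1 := Units.ext (by rw [hι, Units.val_neg, Units.val_one])
    rw [← inv_inv u, hui, hinv]
  have hord : orderOf u = p - 1 := by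
    rw [orderOf_eq_card_of_forall_mem_zpowers hu, Nat.card_eq_fintype_card, ZMod.card_units p]
  have hdvd : orderOf u ∣ 2 := orderOf_dvd_of_pow_eq_one (by rw [hu2, neg_one_sq])
  rw [hord] at hdvd
  have := Nat.le_of_dvd two_pos hdvd
  omega

/-- **Registered sub-goal `stub_cornerVacuous_cyclotomicReducible`** (`--supports stmt-Langlands-13639`,
line `sector-klingen-split`; sub-corner of `stub_klingenDensityCorner`).  For `p ≥ 5`, on a residual fibre
`(σ̄, σ̄')` (both irreducible, `DetC`) carrying an `Sh`-point `ρ`, BOTH `σ̄|Γ_{ℚ(ζ_p)}` and `σ̄'|Γ_{ℚ(ζ_p)}` are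
absolutely irreducible: the "absolutely reducible on `Γ_{ℚ(ζ_p)}`" clauses of `¬ GenericSector` are EMPTY
for `p ≥ 5`.  Proof: an inertia-fixed vector in each constituent (`stub_residualLattice`,
`finrank_invariants_inertia_eq_one`), then `isAbsolutelyIrreducible_restrictField_cyclotomic_of_inertia_fixed`.
[folklore] -/
theorem stub_cornerVacuous_cyclotomicReducible : ∀ (p : ℕ) [Fact p.Prime], 5 ≤ p → ∀ (k : Type) [Field k] [CharP k p] [TopologicalSpace k] [DiscreteTopology k] (red : Valued.integer (PadicAlgCl p) →+* k) (σ σ' : FramedGaloisRep ℚ k 2) (ρ : FramedGaloisRep ℚ (PadicAlgCl p) 4), σ.toGaloisRep.IsIrreducible → σ'.toGaloisRep.IsIrreducible → DetC p k σ σ' → Sh p k red σ σ' ρ → FramedRep.IsAbsolutelyIrreducible (FramedGaloisRep.restrictField (CyclotomicField p ℚ) σ) ∧ FramedRep.IsAbsolutelyIrreducible (FramedGaloisRep.restrictField (CyclotomicField p ℚ) σ') := by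
  intro p _ hp5 k _ _ _ _ red σ σ' ρ hσ hσ' hdet hSh
  have hp2 : p ≠ 2 := by omega
  obtain ⟨v, hv⟩ :=
    Literature.NumberTheory.NumberFields.RingOfIntegers.exists_heightOneSpectrum_natCast_mem ℚ
      (Fact.out : p.Prime)
  obtain ⟨M, hM1, hM2, hM3, -⟩ := stub_residualLattice p hp2 k red σ σ' ρ v hv (hSh.2.1 v hv).1
    (hSh.2.1 v hv).2 hSh.2.2
  obtain ⟨h1, h1'⟩ := finrank_invariants_inertia_eq_one hp2 σ σ' M v hv hσ hσ' hdet hM1 hM2 hM3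
  obtain ⟨w, hw, hfix⟩ := exists_inertia_fixed_of_finrank_invariants_eq_one σ v h1
  obtain ⟨w', hw', hfix'⟩ := exists_inertia_fixed_of_finrank_invariants_eq_one σ' v h1'
  exact ⟨isAbsolutelyIrreducible_restrictField_cyclotomic_of_inertia_fixed hp5 σ hσ
      (fun g => (hdet g).1) v hv hw hfix,
    isAbsolutelyIrreducible_restrictField_cyclotomic_of_inertia_fixed hp5 σ' hσ'
      (fun g => (hdet g).2.trans (hdet g).1) v hv hw' hfix'⟩

/-- **The corner for `p ≥ 5` is the twist fibre.**  Off the generic sector with `p ≥ 5`, a fibre carrying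
an `Sh`-point is a TWIST fibre (`σ̄` conjugate to a pointwise-scalar multiple of `σ̄'`): pure logic over
`stub_cornerVacuous_cyclotomicReducible` and the definition of `GenericSector`. [folklore] -/
theorem twistPair_of_not_genericSector {p : ℕ} [Fact p.Prime] (hp5 : 5 ≤ p) {k : Type} [Field k]
    [CharP k p] [TopologicalSpace k] [DiscreteTopology k] (red : Valued.integer (PadicAlgCl p) →+* k)
    (σ σ' : FramedGaloisRep ℚ k 2) (ρ : FramedGaloisRep ℚ (PadicAlgCl p) 4)
    (hσ : σ.toGaloisRep.IsIrreducible) (hσ' : σ'.toGaloisRep.IsIrreducible) (hdet : DetC p k σ σ')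
    (hSh : Sh p k red σ σ' ρ) (hng : ¬ GenericSector p k σ σ') :
    ∃ g : GL (Fin 2) k, ∀ x, ∃ c : k, (g * σ x * g⁻¹).val = c • (σ' x).val := by
  obtain ⟨ha, ha'⟩ := stub_cornerVacuous_cyclotomicReducible p hp5 k red σ σ' ρ hσ hσ' hdet hSh
  by_contra htw
  exact hng ⟨hp5, ha, ha', htw⟩

end Summit.Langlands.Langlands.Cruxes.ResiduallyYoshidaLifting.SectorKlingenSplit

end
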